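import Literature.IUT.HodgeTheaters.FPrimeStripsMonoLaws
import Literature.IUT.HodgeTheaters.FPrimeStripsRlfOfIsStripSchema
import Literature.IUT.HodgeArakelov.RealifiedDataDegreeTorsor
import Mathlib.CategoryTheory.Groupoid
import HarnessLib

/-!
# [IUTchI] Rmk 5.2.1 (ii) / Ex 3.5 (i)(ii): the `ℱ^⊩` slot of an `ℱ`-prime-strip kit SUPPLIED by the functorial algorithm
# `‡𝔉 ↦ ‡𝔉^⊩ := (‡𝒞^⊩, Prime(‡𝒞^⊩) ⥲ 𝕍, ‡𝔉^⊢, {‡ρ_v}_{v∈𝕍})` at the divisor-monoid level — and `RlfOfIsStrip` as a THEOREM there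

S. Mochizuki, *Inter-universal Teichmüller theory I*, kurims manuscript (May 2020) [paper:url-690e7b3c6199], read on the page:
Rmk 5.2.1 (ii) p. 143 «one may also construct from the `ℱ`-prime-strip `‡𝔉`, via a functorial algorithm [cf. the constructions
of Example 3.5, (i), (ii)], a collection of data `‡𝔉 ↦ ‡𝔉^⊩ := (‡𝒞^⊩, Prime(‡𝒞^⊩) ⥲ 𝕍, ‡𝔉^⊢, {‡ρ_v}_{v∈𝕍})` — i.e., consisting of a
Frobenioid `‡𝒞^⊩`, a bijection `Prime(‡𝒞^⊩) ⥲ 𝕍`, the `ℱ^⊢`-prime-strip `‡𝔉^⊢`, and isomorphisms of topological monoids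
`‡ρ_v : Φ_{‡𝒞^⊩,v} ⥲ Φ^rlf_{‡𝒞^⊢_v}` — which is isomorphic to the collection of data `𝔉^⊩_mod` of Example 3.5, (ii), i.e., which forms
an `ℱ^⊩`-prime-strip [cf. Definition 5.2, (iv)].  Indeed, this follows immediately from the rigidity of the divisor monoids
associated to the Frobenioids that appear at each of the components [indexed by `v ∈ 𝕍`] of an `ℱ`-prime-strip»; Ex 3.5 (i) p. 84
«`ρ_v : Φ_{𝒞^⊩_mod,v} ⥲ Φ^rlf_{𝒞^⊢_v}` … `log^⊢_mod(p_v) ↦ (1/[K_v:(F_mod)_v]) log_Φ(p_v)`», (ii) p. 85 «`𝔉^⊩_mod := (𝒞^⊩_mod,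
Prime(𝒞^⊩_mod) ⥲ 𝕍, 𝔉^⊢_mod, {ρ_v}_{v∈𝕍})`»; Def 5.2 (iv) pp. 134–135 (an `ℱ^⊩`-prime-strip = such a collection (a)–(e) with (f) «isomorphic
to … `ℱ^⊩_mod`», a morphism = «an isomorphism between collections of data»).  Claim key `Mochizuki2012` DISPUTED (D-0012);
nothing of the series is asserted; no side is taken on [IUTchIII] Cor. 3.12.  abc-iut cell, seat abc-iut-w4-d009 (gen 9), K4
RE-CLOSE of FACT-LIST row F-1998 `PMBaseKit.FKit.RlfOfIsStrip` (its ∀-closure over ALL kits is REFUTED, abc-iut-w4-d073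
`not_forall_rlfOfIsStrip`; its only closed producers were the toy kits and the datum form `rlfOfIsStrip_of_model`).

WHAT THIS FILE DOES (ONE kit transformer + its laws; pattern = abc-iut-w4-d005's `BiCoricKit.withRealifiedD`, the [IUTchII] Cor 4.5 (ii)
analogue over this seat's `RlfData` / `realifiedD`).  In abc-iut-L5-t4's interface `FKit` (`FPrimeStrips.lean`) the `ℱ^⊩` slot —
`RlfAmb`, `rlfModel`, `rlfFm`, `rlfOf`, `rlfOfMap`, `rlfFm_rlfOf` — is abstract, so the printed claim of Rmk 5.2.1 (ii) could only be
TAKEN as the hypothesis `RlfOfIsStrip`.  Here, for ANY kit `FK`, the kit `FK.withRlfSlot c hc` keeps every other slot of `FK`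
(`ℱ`, `ℱ^⊢`, `ℱ̲`, `𝒟`, `𝒟^⊢`) UNCHANGED and SUPPLIES the `ℱ^⊩` slot by the printed algorithm at the divisor-monoid level, in the
coordinates of `RealifiedDataDegreeTorsor.lean` (disclosed):
* an object of the ambient category (`RlfSlotObj FK`) is a collection `(‡𝔉^⊢ = {‡ℱ^⊢_v}_v, {c_v}_v)`: the `ℱ^⊢`-datum family [Def 5.2
  (iv) (d)] and the POSITIVE SCALARS of the `‡ρ_v` on the element of arithmetic degree `1` of the prime component `Φ_{‡𝒞^⊩,v} ≅ ℝ_{≥0}`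
  [(a)(b)(c)(e): the realified Frobenioid `‡𝒞^⊩` with `Prime(‡𝒞^⊩) ⥲ 𝕍` enters, as in `RlfData`, through its prime components in degree
  coordinates; its lines `Φ^rlf_{‡𝒞^⊢_v} ∋ log_Φ(p_v)` are the realified divisor lines OF THE COMPONENTS `‡ℱ^⊢_v`, see `toRlfData`];
* a morphism (`RlfSlotObj.Hom`) is an isomorphism of `ℱ^⊢`-prime-strip data `ψ = {ψ_v}` together with the degree `deg > 0` of the
  equivalence of realified Frobenioids `‡𝒞^⊩ ⥲ ‡'𝒞^⊩` ([FrdI] Thm 6.4 (ii)), subject to the `ρ`-compatibility square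
  `deg · c'_v = c_v` for every `v` — which IS the compatibility of the `ρ_v` with the isomorphisms `Φ^rlf_{‡𝒞^⊢_v} ⥲ Φ^rlf_{‡'𝒞^⊢_v}`
  INDUCED by `ψ_v`, because those induced isomorphisms are Frobenius-preserving («the rigidity of the divisor monoids associated
  to the Frobenioids that appear at each of the components»: between two pointed rank-one lines there is EXACTLY ONE linear
  isomorphism matching the distinguished elements, `RLine.eq_frobIso_of_map_frob`) — made precise by `homEquivFrobPreserving`:
  `Hom(X, Y)` ≃ {strip isomorphisms} × {morphisms of this seat's `RlfData` between the interpretations that are Frobenius-preserving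
  at every `v`}, for ANY object-level assignment of pointed divisor lines `dl v : FK.FmAmb v → RLine`;
* `rlfModel := (𝔉^⊢_mod, {c_v})` [Ex 3.5 (ii)], `rlfOf ‡𝔉 := (‡𝔉^⊢ := {toFm_v(‡ℱ_v)}, {c_v})` [Rmk 5.2.1 (ii) «cf. the constructions of Example
  3.5»: the SAME scalars `c_v = 1/[K_v:(F_mod)_v]`, constants of the initial Θ-data], `rlfOfMap ψ := ({toFm_v(ψ_v)}, deg 1)`,
  `rlfFm v :=` the projection `(‡𝔉^⊢, c) ↦ ‡ℱ^⊢_v`, `rlfFm_rlfOf := Iso.refl`.  `rlfModel` is NOT `rlfOf` of the model strip (no tautology):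
  the printed claim has the content «the mono-analyticisation of the model `ℱ`-prime-strip is the model `ℱ^⊢`-prime-strip»
  (`toFm_model`) + functoriality + the rigidity above, and is PROVED: **`rlfOfIsStrip_withRlfSlot : (FK.withRlfSlot c hc).RlfOfIsStrip`**
  with NO hypothesis.
Also: the transports of abc-iut-L5-d4's `MonoLaws` and of abc-iut-L5-t4's named statements Cor 5.3 (ii)/(iii) (`IsomFtoDBijective`,
`IsomFmtoDmSurjective`) to the new kit (they do not involve the `ℱ^⊩` slot), so that every consumer of `(L, hbij, hsurj, hR)` over
`FK` has the same inputs over `FK.withRlfSlot c hc` with `hR` DISCHARGED (sequel: `LogThetaLattice/K4ReclosedIUTchIIIRlfSlot.lean`).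
HONEST SCOPE: the `ℱ^⊢` slot stays the kit's (abstract until abc-iut-L5's genuine kits land); the Frobenioid `‡𝒞^⊩` is recorded
through its prime components / degrees exactly as in `RlfData` (its base category and unit data are realified away, [FrdI] Thm 6.4);
coordinates are ours and disclosed; re-closed-at-a-carrier ≠ proved-in-print; typed ≠ endorsed.
-/

noncomputable section

open CategoryTheory

universe u w

namespace Literature.IUT.HodgeTheaters.PMBaseKit.FKit

open Literature.AnabelianGeometry.AbsoluteAnabelian Literature.IUT.HodgeArakelov

variable {l : ℕ} {K : PMBaseKit.{u} l} {M : K.MultKit}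

/-! ### §1. The ambient category of collections of data `(‡𝒞^⊩, Prime(‡𝒞^⊩) ⥲ 𝕍, ‡𝔉^⊢, {‡ρ_v})` at the divisor-monoid level -/

/-- **IUTchI:Def5.2(iv)** (kurims pp.134–135) a collection of data `(‡𝒞^⊩, Prime(‡𝒞^⊩) ⥲ 𝕍, ‡𝔉^⊢ = {‡ℱ^⊢_v}_v, {‡ρ_v}_v)` at the
divisor-monoid level, over the kit `FK`: the `ℱ^⊢`-datum family (d) and the positive scalars of the `‡ρ_v` (e) on the element of
arithmetic degree `1` of the prime component `Φ_{‡𝒞^⊩,v} ≅ ℝ_{≥0}` (a)(b)(c) — the coordinates of this seat's `RlfData`.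
[cite: Mochizuki2012, Def 5.2 (iv) p.134] -/
structure RlfSlotObj (FK : K.FKit M) : Type u where
  /-- (d) the family `‡𝔉^⊢ = {‡ℱ^⊢_v}_{v∈𝕍}` of `ℱ^⊢`-data -/
  fm : ∀ v, FK.FmAmb v
  /-- (e) `‡ρ_v(element of degree 1 of Φ_{‡𝒞^⊩,v}) = rhoCoeff v · log_Φ(p_v)` -/
  rhoCoeff : K.V → ℝ
  /-- `‡ρ_v` is an isomorphism onto `Φ^rlf_{‡𝒞^⊢_v} ≅ ℝ_{≥0}·log_Φ(p_v)`: the scalar is positive -/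
  rhoCoeff_pos : ∀ v, 0 < rhoCoeff v

namespace RlfSlotObj

variable {FK : K.FKit M}

/-- The scalars are nonzero. [cite: Mochizuki2012, Def 5.2 (iv) p.135] -/
theorem rhoCoeff_ne_zero (X : RlfSlotObj FK) (v : K.V) : X.rhoCoeff v ≠ 0 := (X.rhoCoeff_pos v).ne'

/-- **IUTchI:Def5.2(iv)** (kurims p.135 «A morphism of `ℱ^⊩`-prime-strips is defined to be an isomorphism between collections of data as
discussed above»): an isomorphism `ψ = {ψ_v}` of the `ℱ^⊢`-data together with the degree `deg > 0` of the equivalence of realified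
Frobenioids `‡𝒞^⊩ ⥲ ‡'𝒞^⊩` ([FrdI] Thm 6.4 (ii); it respects `Prime ⥲ 𝕍`), subject to the `ρ`-compatibility square with the
isomorphisms `Φ^rlf_{‡𝒞^⊢_v} ⥲ Φ^rlf_{‡'𝒞^⊢_v}` induced by the `ψ_v` — Frobenius-preserving by the rigidity of the divisor monoids, whence
the square reads `deg · c'_v = c_v` (`homEquivFrobPreserving`). [cite: Mochizuki2012, Def 5.2 (iv) p.135] -/
@[ext]
structure Hom (X Y : RlfSlotObj FK) : Type u where
  /-- the isomorphism of `ℱ^⊢`-prime-strip data -/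
  iso : ∀ v, X.fm v ≅ Y.fm v
  /-- the degree of the equivalence of realified Frobenioids -/
  deg : ℝ
  /-- it is positive -/
  deg_pos : 0 < deg
  /-- compatibility with `‡ρ_v`, `‡'ρ_v` through the (Frobenius-preserving) induced isomorphisms of the lines `Φ^rlf_{‡𝒞^⊢_v}` -/
  compat : ∀ v, deg * Y.rhoCoeff v = X.rhoCoeff v

namespace Hom

variable {X Y Z : RlfSlotObj FK}

/-- The degree is nonzero. [cite: Mochizuki2012, Def 5.2 (iv) p.135] -/
theorem deg_ne_zero (f : Hom X Y) : f.deg ≠ 0 := f.deg_pos.ne'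

/-- The degree of a morphism is FORCED: `deg = c_v / c'_v` at every `v`. [cite: Mochizuki2012, Rmk 5.2.1 (ii) p.143] -/
theorem deg_eq (f : Hom X Y) (v : K.V) : f.deg = X.rhoCoeff v / Y.rhoCoeff v := by
  rw [eq_div_iff (Y.rhoCoeff_ne_zero v), f.compat]

/-- A morphism is determined by its isomorphism of `ℱ^⊢`-data as soon as `𝕍` is inhabited. [cite: Mochizuki2012, Rmk 5.2.1 (ii) p.143] -/
theorem ext_of_iso_eq (v : K.V) {f g : Hom X Y} (h : f.iso = g.iso) : f = g :=
  Hom.ext h (by rw [f.deg_eq v, g.deg_eq v])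

/-- The identity. [cite: Mochizuki2012, Def 5.2 (iv) p.135] -/
protected def id (X : RlfSlotObj FK) : Hom X X where
  iso _ := Iso.refl _
  deg := 1
  deg_pos := one_pos
  compat _ := one_mul _

/-- Composition (degrees multiply). [cite: Mochizuki2012, Def 5.2 (iv) p.135] -/
protected def comp (f : Hom X Y) (g : Hom Y Z) : Hom X Z where
  iso v := f.iso v ≪≫ g.iso v
  deg := f.deg * g.deg
  deg_pos := mul_pos f.deg_pos g.deg_pos
  compat v := by rw [mul_assoc, g.compat, f.compat]

/-- The inverse (degree `deg⁻¹`). [cite: Mochizuki2012, Def 5.2 (iv) p.135] -/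
protected def inv (f : Hom X Y) : Hom Y X where
  iso v := (f.iso v).symm
  deg := f.deg⁻¹
  deg_pos := inv_pos.mpr f.deg_pos
  compat v := by rw [← f.compat v, ← mul_assoc, inv_mul_cancel₀ f.deg_ne_zero, one_mul]

end Hom

/-- **IUTchI:Def5.2(iv)** (kurims p.135) the CATEGORY of collections of data `(‡𝒞^⊩, Prime ⥲ 𝕍, ‡𝔉^⊢, {‡ρ_v})` and their isomorphisms.
[cite: Mochizuki2012, Def 5.2 (iv) p.135] -/
instance instCategory : Category (RlfSlotObj FK) where
  Hom := Hom
  id := Hom.id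
  comp := Hom.comp
  id_comp f := Hom.ext (funext fun _ => Iso.refl_trans _) (one_mul f.deg)
  comp_id f := Hom.ext (funext fun _ => Iso.trans_refl _) (mul_one f.deg)
  assoc f g h := Hom.ext (funext fun _ => Iso.trans_assoc _ _ _) (mul_assoc f.deg g.deg h.deg)

/-- The identity is `({𝟙}, 1)`. [cite: Mochizuki2012, Def 5.2 (iv) p.135] -/
@[simp] theorem id_iso (X : RlfSlotObj FK) (v : K.V) : (𝟙 X : X ⟶ X).iso v = Iso.refl _ := rfl
/-- The identity has degree `1`. [cite: Mochizuki2012, Def 5.2 (iv) p.135] -/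
@[simp] theorem id_deg (X : RlfSlotObj FK) : (𝟙 X : X ⟶ X).deg = 1 := rfl
/-- Composition composes the strip isomorphisms. [cite: Mochizuki2012, Def 5.2 (iv) p.135] -/
@[simp] theorem comp_iso {X Y Z : RlfSlotObj FK} (f : X ⟶ Y) (g : Y ⟶ Z) (v : K.V) :
    (f ≫ g).iso v = f.iso v ≪≫ g.iso v := rfl
/-- Degrees multiply. [cite: Mochizuki2012, Def 5.2 (iv) p.135] -/
@[simp] theorem comp_deg {X Y Z : RlfSlotObj FK} (f : X ⟶ Y) (g : Y ⟶ Z) : (f ≫ g).deg = f.deg * g.deg := rfl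

/-- **IUTchI:Def5.2(iv)** (kurims p.135) every morphism is an isomorphism: a GROUPOID. [cite: Mochizuki2012, Def 5.2 (iv) p.135] -/
instance instGroupoid : Groupoid (RlfSlotObj FK) where
  inv := Hom.inv
  inv_comp f := Hom.ext (funext fun _ => Iso.symm_self_id _) (inv_mul_cancel₀ f.deg_ne_zero)
  comp_inv f := Hom.ext (funext fun _ => Iso.self_symm_id _) (mul_inv_cancel₀ f.deg_ne_zero)

/-- The isomorphism of collections of data with given strip isomorphisms and degree. [cite: Mochizuki2012, Def 5.2 (iv) p.135] -/
def isoMk {X Y : RlfSlotObj FK} (ψ : ∀ v, X.fm v ≅ Y.fm v) (d : ℝ) (hd : 0 < d) (h : ∀ v, d * Y.rhoCoeff v = X.rhoCoeff v) :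
    X ≅ Y :=
  (Groupoid.isoEquivHom X Y).symm ⟨ψ, d, hd, h⟩

/-- `isoMk` has the given strip isomorphisms. [cite: Mochizuki2012, Def 5.2 (iv) p.135] -/
@[simp] theorem isoMk_hom_iso {X Y : RlfSlotObj FK} (ψ : ∀ v, X.fm v ≅ Y.fm v) (d : ℝ) (hd : 0 < d)
    (h : ∀ v, d * Y.rhoCoeff v = X.rhoCoeff v) (v : K.V) : (isoMk ψ d hd h).hom.iso v = ψ v := rfl

/-- Two collections of data with THE SAME scalars are isomorphic by any isomorphism of their `ℱ^⊢`-data, in degree `1`.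
[cite: Mochizuki2012, Rmk 5.2.1 (ii) p.143] -/
def isoOfStripIso {X Y : RlfSlotObj FK} (ψ : ∀ v, X.fm v ≅ Y.fm v) (h : X.rhoCoeff = Y.rhoCoeff) : X ≅ Y :=
  isoMk ψ 1 one_pos fun v => by rw [one_mul, h]

/-- There is NO isomorphism between collections of data whose scalars are not proportional (the degree is one scalar for all
`v`): e.g. none of degree other than `c_v/c'_v`. [cite: Mochizuki2012, Rmk 5.2.1 (ii) p.143] -/
theorem isEmpty_hom_of_not_prop {X Y : RlfSlotObj FK} (h : ¬ ∃ d : ℝ, 0 < d ∧ ∀ v, d * Y.rhoCoeff v = X.rhoCoeff v) :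
    IsEmpty (X ⟶ Y) :=
  ⟨fun f => h ⟨f.deg, f.deg_pos, f.compat⟩⟩

/-! ### §2. Interpretation in `RlfData`: the lines `Φ^rlf_{‡𝒞^⊢_v} ∋ log_Φ(p_v)` of the components and the rigidity of the divisor monoids -/

section Interpretation

variable (dl : ∀ v, FK.FmAmb v → RLine.{w})

/-- **IUTchI:Rmk5.2.1(ii)** (kurims p.143) the collection `(‡𝒞^⊩, Prime(‡𝒞^⊩) ⥲ 𝕍, {‡ρ_v})` underlying an object, as an object of this seat's
`RlfData 𝕍` ([IUTchII] Cor 4.5 (ii) coordinates), for an object-level assignment `dl` of the pointed realified divisor lines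
`Φ^rlf_{‡𝒞^⊢_v} ∋ log_Φ(p_v)` to `ℱ^⊢`-data ([IUTchI] Ex 3.2 (iv)/(v), 3.3 (i), 3.4 (ii): «a single abstract monoid isomorphic to `ℝ_{≥0}`»
with the element determined by `p_v`). [cite: Mochizuki2012, Rmk 5.2.1 (ii) p.143] -/
abbrev toRlfData (X : RlfSlotObj FK) : RlfData.{0, w} K.V := ⟨fun v => dl v (X.fm v), X.rhoCoeff, X.rhoCoeff_pos⟩

/-- `toRlfData` has the scalars of the object. [cite: Mochizuki2012, Rmk 5.2.1 (ii) p.143] -/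
@[simp] theorem toRlfData_rhoCoeff (X : RlfSlotObj FK) : (X.toRlfData dl).rhoCoeff = X.rhoCoeff := rfl

/-- **IUTchI:Rmk5.2.1(ii)** (kurims p.143 «the rigidity of the divisor monoids associated to the Frobenioids that appear at each of the
components») the morphism of `(‡𝒞^⊩, Prime ⥲ 𝕍, {‡ρ_v})`-data underlying a morphism: degree `deg`, and at each `v` THE pointed
isomorphism `Φ^rlf_{‡𝒞^⊢_v} ⥲ Φ^rlf_{‡'𝒞^⊢_v}` (`RLine.frobIso`, the only linear isomorphism matching `log_Φ(p_v)`'s — the shape of every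
isomorphism induced by `ψ_v`); the `ρ`-square commutes BECAUSE `deg · c'_v = c_v`. [cite: Mochizuki2012, Rmk 5.2.1 (ii) p.143] -/
def Hom.toRlfHom {X Y : RlfSlotObj FK} (f : X ⟶ Y) : X.toRlfData dl ⟶ Y.toRlfData dl where
  deg := f.deg
  deg_pos := f.deg_pos
  lineIso v := RLine.frobIso (dl v (X.fm v)) (dl v (Y.fm v))
  compat v := by rw [map_smul, RLine.frobIso_frob, f.compat]

/-- The underlying morphism of data has the same degree. [cite: Mochizuki2012, Rmk 5.2.1 (ii) p.143] -/
@[simp] theorem Hom.toRlfHom_deg {X Y : RlfSlotObj FK} (f : X ⟶ Y) : (Hom.toRlfHom dl f).deg = f.deg := rfl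

/-- The underlying morphism of data is Frobenius-preserving at every `v` (`log_Φ(p_v) ↦ log_Φ(p_v)`).
[cite: Mochizuki2012, Rmk 5.2.1 (ii) p.143] -/
theorem Hom.toRlfHom_isFrobPreservingAt {X Y : RlfSlotObj FK} (f : X ⟶ Y) (v : K.V) :
    RlfData.Hom.IsFrobPreservingAt (Hom.toRlfHom dl f) v :=
  RLine.frobIso_frob _ _

/-- **IUTchI:Rmk5.2.1(ii)** (kurims p.143) the interpretation FUNCTOR `(‡𝔉^⊢, c) ↦ (‡𝒞^⊩, Prime(‡𝒞^⊩) ⥲ 𝕍, {‡ρ_v})` into this seat's `RlfData 𝕍`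
(functorial because the pointed line isomorphisms compose, `RLine.frobIso_trans`). [cite: Mochizuki2012, Rmk 5.2.1 (ii) p.143] -/
def toRlfDataFunctor : RlfSlotObj FK ⥤ RlfData.{0, w} K.V where
  obj X := X.toRlfData dl
  map f := Hom.toRlfHom dl f
  map_id _ := RlfData.Hom.ext_of_deg_eq rfl
  map_comp _ _ := RlfData.Hom.ext_of_deg_eq rfl

/-- **IUTchI:Rmk5.2.1(ii)** (kurims p.143) FAITHFULNESS CERTIFICATE of the typing: a morphism of collections of data
`(‡𝒞^⊩, Prime ⥲ 𝕍, ‡𝔉^⊢, {‡ρ_v}) ⥲ (‡'𝒞^⊩, …)` IS EXACTLY a pair (isomorphism `ψ` of `ℱ^⊢`-prime-strip data, isomorphism of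
`(𝒞^⊩, Prime ⥲ 𝕍, {ρ_v})`-data in `RlfData`) whose local line isomorphisms are the Frobenius-preserving ones — the ones induced by the
`ψ_v` under the rigidity of the divisor monoids — for ANY assignment `dl` of pointed divisor lines. [cite: Mochizuki2012, Rmk 5.2.1 (ii) p.143] -/
def homEquivFrobPreserving (X Y : RlfSlotObj FK) :
    (X ⟶ Y) ≃ (∀ v, X.fm v ≅ Y.fm v) ×
      {g : X.toRlfData dl ⟶ Y.toRlfData dl // ∀ v, RlfData.Hom.IsFrobPreservingAt g v} where
  toFun f := ⟨f.iso, Hom.toRlfHom dl f, Hom.toRlfHom_isFrobPreservingAt dl f⟩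
  invFun p :=
    { iso := p.1
      deg := p.2.1.deg
      deg_pos := p.2.1.deg_pos
      compat := fun v => by
        rw [RlfData.deg_eq_of_isFrobPreservingAt p.2.1 v (p.2.2 v), toRlfData_rhoCoeff, toRlfData_rhoCoeff,
          div_mul_cancel₀ _ (Y.rhoCoeff_ne_zero v)] }
  left_inv f := Hom.ext rfl rfl
  right_inv p := by
    refine Prod.ext rfl (Subtype.ext (RlfData.Hom.ext_of_deg_eq rfl))

/-- In particular an ENDOMORPHISM of a collection of data induces the IDENTITY of `(‡𝒞^⊩, Prime ⥲ 𝕍, {‡ρ_v})` (although that category is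
not rigid, `RlfData.dilate_ne_id`): the kernel of the rigidity (`𝕍 ≠ ∅`; over an empty `𝕍` degrees are unconstrained).
[cite: Mochizuki2012, Rmk 5.2.1 (ii) p.143] -/
theorem Hom.toRlfHom_endo [Nonempty K.V] {X : RlfSlotObj FK} (f : X ⟶ X) : Hom.toRlfHom dl f = 𝟙 (X.toRlfData dl) := by
  obtain ⟨v⟩ := ‹Nonempty K.V›
  exact RlfData.eq_id_of_isFrobPreservingAt _ v (Hom.toRlfHom_isFrobPreservingAt dl f v)

/-- … and an endomorphism has degree `1` (`𝕍 ≠ ∅`). [cite: Mochizuki2012, Rmk 5.2.1 (ii) p.143] -/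
theorem Hom.deg_endo [Nonempty K.V] {X : RlfSlotObj FK} (f : X ⟶ X) : f.deg = 1 := by
  obtain ⟨v⟩ := ‹Nonempty K.V›
  rw [f.deg_eq v, div_self (X.rhoCoeff_ne_zero v)]

end Interpretation

end RlfSlotObj

/-! ### §3. The kit transformer: the `ℱ^⊩` slot SUPPLIED by the algorithm of Rmk 5.2.1 (ii) / Ex 3.5 (i)(ii) -/

section WithRlfSlot

variable (FK : K.FKit M) (c : K.V → ℝ) (hc : ∀ v, 0 < c v)

/-- **IUTchI:Rmk5.2.1(ii)** (kurims p.143) the `ℱ^⊢`-component functor `(‡𝔉^⊢, c) ↦ ‡ℱ^⊢_v` of the ambient category (datum (d) at `v`).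
[cite: Mochizuki2012, Rmk 5.2.1 (ii) p.143] -/
def RlfSlotObj.fmFunctor (v : K.V) : RlfSlotObj FK ⥤ FK.FmAmb v where
  obj X := X.fm v
  map f := (f.iso v).hom

/-- **IUTchI:Rmk5.2.1(ii)** / **IUTchI:Ex3.5(ii)** (kurims p.143 / p.85) **`FK.withRlfSlot c hc`** — the kit `FK` with its `ℱ`, `ℱ^⊢`, `ℱ̲`, `𝒟`,
`𝒟^⊢` slots UNCHANGED and its `ℱ^⊩` slot SUPPLIED at the divisor-monoid level: ambient category `RlfSlotObj FK` (§1); model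
`𝔉^⊩_mod := (𝔉^⊢_mod, {c_v})` with `c_v` the scalars of Ex 3.5 (i) «`log^⊢_mod(p_v) ↦ (1/[K_v:(F_mod)_v]) log_Φ(p_v)`»; the algorithm
`‡𝔉 ↦ ‡𝔉^⊩ := (‡𝔉^⊢ = {toFm_v ‡ℱ_v}, {c_v})` «cf. the constructions of Example 3.5, (i), (ii)» (same constants of the initial Θ-data) and
on isomorphisms `ψ ↦ ({toFm_v ψ_v}, deg 1)`; components `rlfFm v :=` the projection; `rlfFm_rlfOf := Iso.refl` («consisting of … the
`ℱ^⊢`-prime-strip `‡𝔉^⊢`»). [cite: Mochizuki2012, Rmk 5.2.1 (ii) p.143] -/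
def withRlfSlot : K.FKit M :=
  { FK with
    RlfAmb := RlfSlotObj FK
    catRlf := RlfSlotObj.instCategory
    rlfModel := ⟨FK.fmModel, c, hc⟩
    rlfFm := RlfSlotObj.fmFunctor FK
    rlfOf := fun F => ⟨fun v => (FK.toFm v).obj (F v), c, hc⟩
    rlfOfMap := fun φ => RlfSlotObj.isoOfStripIso (fun v => (FK.toFm v).mapIso (φ v)) rfl
    rlfFm_rlfOf := fun _ _ => Iso.refl _ }

/-- The `ℱ` slot is unchanged. [cite: Mochizuki2012, Rmk 5.2.1 (ii) p.143] -/
@[simp] theorem withRlfSlot_FAmb : (FK.withRlfSlot c hc).FAmb = FK.FAmb := rfl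
/-- The model `ℱ_v` is unchanged. [cite: Mochizuki2012, Rmk 5.2.1 (ii) p.143] -/
@[simp] theorem withRlfSlot_fModel : (FK.withRlfSlot c hc).fModel = FK.fModel := rfl
/-- The `ℱ^⊢` slot is unchanged. [cite: Mochizuki2012, Rmk 5.2.1 (ii) p.143] -/
@[simp] theorem withRlfSlot_FmAmb : (FK.withRlfSlot c hc).FmAmb = FK.FmAmb := rfl
/-- The model `ℱ^⊢_v` is unchanged. [cite: Mochizuki2012, Rmk 5.2.1 (ii) p.143] -/
@[simp] theorem withRlfSlot_fmModel : (FK.withRlfSlot c hc).fmModel = FK.fmModel := rfl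
/-- `𝔉 ↦ 𝔇` is unchanged. [cite: Mochizuki2012, Rmk 5.2.1 (i) p.143] -/
@[simp] theorem withRlfSlot_toD : (FK.withRlfSlot c hc).toD = FK.toD := rfl
/-- `𝔉 ↦ 𝔉^⊢` is unchanged. [cite: Mochizuki2012, Rmk 5.2.1 (ii) p.143] -/
@[simp] theorem withRlfSlot_toFm : (FK.withRlfSlot c hc).toFm = FK.toFm := rfl
/-- `𝔉^⊢ ↦ 𝔇^⊢` is unchanged. [cite: Mochizuki2012, Rmk 5.2.1 (i) p.143] -/
@[simp] theorem withRlfSlot_toDm : (FK.withRlfSlot c hc).toDm = FK.toDm := rfl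
/-- The `ℱ̲` slot is unchanged. [cite: Mochizuki2012, Def 3.6 p.87] -/
@[simp] theorem withRlfSlot_ThAmb : (FK.withRlfSlot c hc).ThAmb = FK.ThAmb := rfl
/-- The `ℱ^⊩` ambient category is the category of §1. [cite: Mochizuki2012, Def 5.2 (iv) p.134] -/
theorem withRlfSlot_RlfAmb : (FK.withRlfSlot c hc).RlfAmb = RlfSlotObj FK := rfl
/-- The model `𝔉^⊩_mod = (𝔉^⊢_mod, {c_v})`. [cite: Mochizuki2012, Ex 3.5 (ii) p.85] -/
theorem withRlfSlot_rlfModel : (FK.withRlfSlot c hc).rlfModel = ⟨FK.fmModel, c, hc⟩ := rfl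
/-- The algorithm on objects: `‡𝔉^⊩ = ({toFm_v ‡ℱ_v}, {c_v})`. [cite: Mochizuki2012, Rmk 5.2.1 (ii) p.143] -/
theorem withRlfSlot_rlfOf (F : ∀ v, FK.FAmb v) :
    (FK.withRlfSlot c hc).rlfOf F = ⟨fun v => (FK.toFm v).obj (F v), c, hc⟩ := rfl
/-- The algorithm on isomorphisms has degree `1`. [cite: Mochizuki2012, Rmk 5.2.1 (ii) p.143] -/
theorem withRlfSlot_rlfOfMap_deg {F₁ F₂ : ∀ v, FK.FAmb v} (φ : ∀ v, F₁ v ≅ F₂ v) :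
    ((FK.withRlfSlot c hc).rlfOfMap φ).hom.deg = 1 := rfl
/-- … and strip part `{toFm_v ψ_v}`. [cite: Mochizuki2012, Rmk 5.2.1 (ii) p.143] -/
theorem withRlfSlot_rlfOfMap_iso {F₁ F₂ : ∀ v, FK.FAmb v} (φ : ∀ v, F₁ v ≅ F₂ v) (v : K.V) :
    ((FK.withRlfSlot c hc).rlfOfMap φ).hom.iso v = (FK.toFm v).mapIso (φ v) := rfl

/-! ### §4. Rmk 5.2.1 (ii) «which is isomorphic to … `ℱ^⊩_mod`» PROVED for the supplied slot -/

/-- **IUTchI:Rmk5.2.1(ii)** (kurims p.143) the algorithm sends the model `ℱ`-prime-strip to an isomorph of `𝔉^⊩_mod`: THE isomorphism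
`({toFm_v ℱ_v}, c) ⥲ (𝔉^⊢_mod, c)` given by `toFm_model` («the mono-analyticisation of the model is the model», Rmk 5.2.1 (ii) / Ex 3.2 (vi)
(f), 3.3 (iii) (e), 3.4 (ii)) in degree `1`. [cite: Mochizuki2012, Rmk 5.2.1 (ii) p.143] -/
def withRlfSlot_rlfOfModelIso : (FK.withRlfSlot c hc).rlfOf (FK.withRlfSlot c hc).fModel ≅ (FK.withRlfSlot c hc).rlfModel :=
  RlfSlotObj.isoOfStripIso (fun v => FK.toFm_model v) rfl

/-- **IUTchI:Rmk5.2.1(ii)** (kurims p.143 «`‡𝔉 ↦ ‡𝔉^⊩` … which is isomorphic to the collection of data `ℱ^⊩_mod` of Example 3.5, (ii), i.e., which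
forms an `ℱ^⊩`-prime-strip … this follows immediately from the rigidity of the divisor monoids …») — abc-iut-L5-t4's NAMED statement
`RlfOfIsStrip` (FACT-LIST F-1998; ∀-closure over all kits REFUTED, `not_forall_rlfOfIsStrip`) is a **THEOREM for the kit with the supplied
`ℱ^⊩` slot**, for EVERY kit `FK` and every choice of positive scalars, with NO hypothesis. [cite: Mochizuki2012, Rmk 5.2.1 (ii) p.143] -/
theorem rlfOfIsStrip_withRlfSlot : (FK.withRlfSlot c hc).RlfOfIsStrip :=
  rlfOfIsStrip_of_model (FK.withRlfSlot_rlfOfModelIso c hc)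

/-- Hence every `ℱ`-prime-strip `‡𝔉` of the kit HAS its `ℱ^⊩`-prime-strip `‡𝔉^⊩` (abc-iut-L5-t4's `FStrip.rlf`, no hypothesis left).
[cite: Mochizuki2012, Rmk 5.2.1 (ii) p.143] -/
def FStrip.rlfOfSlot (F : (FK.withRlfSlot c hc).FStrip) : (FK.withRlfSlot c hc).FrStrip :=
  F.rlf (FK.rlfOfIsStrip_withRlfSlot c hc)

/-- … whose `ℱ^⊢`-prime-strip is the mono-analyticisation `‡𝔉^⊢` ON THE NOSE. [cite: Mochizuki2012, Rmk 5.2.1 (ii) p.143] -/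
theorem FStrip.rlfOfSlot_fm (F : (FK.withRlfSlot c hc).FStrip) (v : K.V) :
    (FStrip.rlfOfSlot FK c hc F).obj.fm v = (FK.toFm v).obj (F.obj v) := rfl

/-- The consequence abc-iut-L6's frame assembly consumes (`nonempty_rlfFm_rlfModel_iso_of_rlfOfIsStrip`): the `v`-component of
`𝔉^⊩_mod` is an isomorph of `ℱ^⊢_v` — here it IS `ℱ^⊢_v`. [cite: Mochizuki2012, Ex 3.5 (ii) p.85] -/
theorem withRlfSlot_rlfFm_rlfModel (v : K.V) :
    ((FK.withRlfSlot c hc).rlfFm v).obj (FK.withRlfSlot c hc).rlfModel = FK.fmModel v := rfl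

/-! ### §5. Transport of the other named inputs (they do not involve the `ℱ^⊩` slot) -/

/-- **IUTchI:Cor5.3(ii)** (kurims p.144) abc-iut-L5-t4's `IsomFtoDBijective` for the new kit is the SAME statement (the `ℱ` slot and `𝔉 ↦ 𝔇` are
unchanged; via abc-iut-L5-t4's reduction to the model). [cite: Mochizuki2012, Cor 5.3 (ii) p.144] -/
theorem isomFtoDBijective_withRlfSlot_iff : (FK.withRlfSlot c hc).IsomFtoDBijective ↔ FK.IsomFtoDBijective := by
  rw [isomFtoDBijective_iff_model, isomFtoDBijective_iff_model]; exact Iff.rfl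

/-- **IUTchI:Cor5.3(ii)** (kurims p.144) … forward transport. [cite: Mochizuki2012, Cor 5.3 (ii) p.144] -/
theorem isomFtoDBijective_withRlfSlot (h : FK.IsomFtoDBijective) : (FK.withRlfSlot c hc).IsomFtoDBijective :=
  (FK.isomFtoDBijective_withRlfSlot_iff c hc).mpr h

/-- **IUTchI:Cor5.3(iii)** (kurims p.144) abc-iut-L5-t4's `IsomFmtoDmSurjective` transports to the new kit (the `ℱ^⊢` slot and `𝔉^⊢ ↦ 𝔇^⊢`
are unchanged; an `ℱ^⊢`-prime-strip of either kit is one of the other with the same data). [cite: Mochizuki2012, Cor 5.3 (iii) p.144] -/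
theorem isomFmtoDmSurjective_withRlfSlot (h : FK.IsomFmtoDmSurjective) : (FK.withRlfSlot c hc).IsomFmtoDmSurjective :=
  fun F₁ F₂ => h ⟨F₁.obj, F₁.isModel⟩ ⟨F₂.obj, F₂.isModel⟩

/-- **IUTchI:Cor5.3(iii)** (kurims p.144) … and back. [cite: Mochizuki2012, Cor 5.3 (iii) p.144] -/
theorem isomFmtoDmSurjective_of_withRlfSlot (h : (FK.withRlfSlot c hc).IsomFmtoDmSurjective) : FK.IsomFmtoDmSurjective :=
  fun F₁ F₂ => h ⟨F₁.obj, F₁.isModel⟩ ⟨F₂.obj, F₂.isModel⟩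

variable {FK}

/-- **IUTchI:Rmk5.2.1(i)** (kurims p.143) abc-iut-L5-d4's `MonoLaws` (laws of `𝔉^⊢ ↦ 𝔇^⊢`, `𝔇 ↦ 𝔇^⊢` and the chosen compatibility
`(‡𝔉^⊢)^{𝒟^⊢} ≅ (‡𝔇)^⊢`) transported to the new kit VERBATIM (none of them involves the `ℱ^⊩` slot). [cite: Mochizuki2012, Rmk 5.2.1 (i) p.143] -/
def MonoLaws.withRlfSlot (L : FK.MonoLaws) : (FK.withRlfSlot c hc).MonoLaws where
  toDmMap_refl := L.toDmMap_refl
  toDmMap_trans := L.toDmMap_trans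
  monoMap_refl := L.monoMap_refl
  monoMap_trans := L.monoMap_trans
  toDmToFm F := L.toDmToFm ⟨F.obj, F.isModel⟩
  toDmToFm_natural {F₁ F₂} φ := L.toDmToFm_natural (F₁ := ⟨F₁.obj, F₁.isModel⟩) (F₂ := ⟨F₂.obj, F₂.isModel⟩) φ

/-- The transported compatibility isomorphism is the original one. [cite: Mochizuki2012, Rmk 5.2.1 (i) p.143] -/
theorem MonoLaws.withRlfSlot_toDmToFm (L : FK.MonoLaws) (F : (FK.withRlfSlot c hc).FStrip) :
    (L.withRlfSlot c hc).toDmToFm F = L.toDmToFm ⟨F.obj, F.isModel⟩ := rfl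

end WithRlfSlot

/-! ### §6. Consistency: the supplied slot over the toy kit, and non-rigidity of the ambient category away from the components -/

/-- Over abc-iut-L5-t4's toy kit (prime `l ≠ 2`) with unit scalars, the supplied `ℱ^⊩` slot's model is `(toy 𝔉^⊢_mod, 1)` — an honest
inhabitant. [cite: Mochizuki2012, Def 5.2 (iv) p.134] -/
theorem withRlfSlot_toy_rlfModel (l : ℕ) [Fact l.Prime] (hl : l ≠ 2) :
    ((FKit.toy l hl).withRlfSlot (fun _ => 1) (fun _ => one_pos)).rlfModel = ⟨(FKit.toy l hl).fmModel, fun _ => 1, fun _ => one_pos⟩ :=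
  rfl

end Literature.IUT.HodgeTheaters.PMBaseKit.FKit
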